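import Mathlib
import HarnessLib.Audit
import Summits.PneNP.PneNP.Theorems.PstarChordReadNor
import Summits.PneNP.PneNP.Theorems.PstarChordReadOutsideKill

/-!
# THE TWO-CHORD THEOREM: two outside-gated slice-generic chords without a common partner kill a terminal core (memo g21 §16)

FRONTIER range-avoidance ladder, rung F-N3, ROUND 24 (cell `pnp-ideate`, prover-2 memos `g19/O1-CHORD-READ.md`, `g20/O1-CHORD-READ-g20.md` §13–§14,
`g21/O1-CHORD-READ-g21.md` §15–§16; typed target `PstarCoreBoundTargets.TerminalPeelable` (p646951); restricted-model proof complexity — nothing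
here bears on `P` versus `NP`).

`PstarChordReadOutsideKill.false_of_two_outsideGated` needed the two chords UNLINKED (no monomial coupling their switches).  Here the coupling
hypothesis is REMOVED: the only structural hypothesis left is that no outside variable is a partner of both chords — automatic at exact tightness,
where two privates never share a gate partner (memo g19 §4).

* `false_of_two_gated_typeI` — type `(1,0)`: `PstarChordReadPrivSwitch.type_eq'` (uniform type via private/switch rank one), `not_mem_lin₂'`,
  then the INVISIBLE/FULL dichotomy for the designated switches `zᵢ, zⱼ` (`mv₂_eq_of_typeI`, `invisible_of_mv₂_zero`, `full_of_mv₂_eq`); mixed is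
  impossible (the coupling `(zᵢ, zⱼ) ∈ G₂` is symmetric); INVISIBLE–INVISIBLE dies by `PstarChordReadOutsideClean.chordLocal₂_of_clean` at both
  chords; FULL–FULL dies by `PstarChordReadNor.false_of_full` (`Γ₂ ≡ ¬b₂ ⊕ NOR` of the two private directions).
* **`false_of_two_gated` — THE TWO-CHORD THEOREM.**  On a pure typed `(r,3/2)`-expanding instance with simple overlaps, a terminal core has no two
  distinct chords that are OUTSIDE-GATED (every monomial of `Γ₁, Γ₂` touching the AND pair is a gate `(v, z)` with `z` outside the core), share NO
  PARTNER, and are SLICE-GENERIC.  All gate types (reader symmetries `terminal_symm`, `terminal_sum`); nothing assumed about the other attachments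
  of the partners — in particular the two chords' switches may be coupled arbitrarily (complete bipartite `G₂`-coupling is the only pattern that
  survives the dichotomy, and it is the NOR mechanism of the `k = 3, 5` terminal cores CONS-T/CONS-P3, killed here by the two generic chords).

CONSEQUENCE for tight `k = 12` (memo g21 §16.6): at exact tightness every chord is outside-gated and no two privates share a partner
(`PstarMaxSharingReaders.partner_fresh_of_tight` and the boundary count), so a terminal configuration on any of the 1800 tight O1 structures would
need all but at most one of its six chords slice-DEGENERATE — against the certificate (kit j314774: at least five of six are slice-generic for every
fibre class).  Genericity used: `SliceGeneric` at the two chords, nothing else.  No Assumption A.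
-/

set_option linter.dupNamespace false -- `Summit.PneNP.PneNP.…`: summit = sub-problem name (D-0017 single-conjunct layout)

open Finset Literature.Computability.Complexity
open scoped symmDiff
open Summit.PneNP.PneNP.Theorems.PstarFibrePolys (bit bit_injective)
open Summit.PneNP.PneNP.Theorems.PstarTyped (Typed)
open Summit.PneNP.PneNP.Theorems.PstarSALevel (varSet bdry BoundaryExpanding SimpleOverlap)
open Summit.PneNP.PneNP.Theorems.PstarGapPeeling (not_mem_varSet_of_private)
open Summit.PneNP.PneNP.Theorems.PstarCentreFree (vars_mem_varSet)
open Summit.PneNP.PneNP.Theorems.PstarGapOneAll (gval)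
open Summit.PneNP.PneNP.Theorems.PstarChordRepair (IsChord)
open Summit.PneNP.PneNP.Theorems.PstarCoreBoundTargets (Terminal)
open Summit.PneNP.PneNP.Theorems.PstarFreshEraseGates (terminal_symm)
open Summit.PneNP.PneNP.Theorems.PstarChordReadLemma (ChordLocal SliceGeneric false_of_monomial_free_chord)
open Summit.PneNP.PneNP.Theorems.PstarChordReadSwitch (gval_eq_false_of_two_chordLocal false_of_gval₂_const)
open Summit.PneNP.PneNP.Theorems.PstarChordReadGates (sliceGeneric_mono exists_two_slices)
open Summit.PneNP.PneNP.Theorems.PstarChordReadTwoGates (exists_xor_not_mem_of_simpleOverlap)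
open Summit.PneNP.PneNP.Theorems.PstarChordReadSwitches (Touches)
open Summit.PneNP.PneNP.Theorems.PstarChordReadFlip
open Summit.PneNP.PneNP.Theorems.PstarChordReadOutside
open Summit.PneNP.PneNP.Theorems.PstarChordReadOutsideClean
open Summit.PneNP.PneNP.Theorems.PstarChordReadOutsideKill (terminal_sum union_symmDiff_eq exists_copriv copriv_false avoids_of_not_touches)
open Summit.PneNP.PneNP.Theorems.PstarChordReadPrivSwitch
open Summit.PneNP.PneNP.Theorems.PstarChordReadNor

namespace Summit.PneNP.PneNP.Theorems.PstarChordReadTwoChords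

variable {n m : ℕ}

/-! ## Bookkeeping from outside-gatedness and the no-common-partner hypothesis -/
section Book

variable {I : LocalMap 4 n m} {J₀ : Finset (Fin m)} {𝒢 : Finset (Fin m)} {cᵢ cⱼ : Fin m}

/-- **No common partner ⟹ no monomial pairs a partner of `cᵢ` with a private of `cⱼ`** (it would make it a partner of `cⱼ`). -/
theorem no_pair_priv' (hnsh : ∀ z, Partner I J₀ 𝒢 cᵢ z → Partner I J₀ 𝒢 cⱼ z → False) (hOⱼ : OutsideGated I J₀ 𝒢 cⱼ) (hcⱼ : cⱼ ∈ J₀)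
    {z : Fin n} (hz : Partner I J₀ 𝒢 cᵢ z) {v : Fin n} (hv : v = I.vars cⱼ 2 ∨ v = I.vars cⱼ 3) :
    ∀ h ∈ 𝒢, ¬ ((I.vars h 2 = v ∧ I.vars h 3 = z) ∨ (I.vars h 2 = z ∧ I.vars h 3 = v)) := by
  intro h hh H
  obtain ⟨g₀, hg₀, v₀, hg₀G⟩ := hz
  have hzout : ∀ j ∈ J₀, z ∉ varSet I j := hg₀G.2.2
  have hvmem : v ∈ varSet I cⱼ := by
    rcases hv with e | e <;> rw [e] <;> exact vars_mem_varSet I cⱼ _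
  have hvz : v ≠ z := fun e => hzout cⱼ hcⱼ (e ▸ hvmem)
  have hgv : I.vars h 2 = v ∨ I.vars h 3 = v := by
    rcases H with ⟨h2, -⟩ | ⟨-, h3⟩
    exacts [Or.inl h2, Or.inr h3]
  obtain ⟨z', hG⟩ := exists_gate_of_slot hOⱼ hcⱼ hh hv hgv
  have hzz' : z = z' := by
    rcases H with ⟨k2, k3⟩ | ⟨k2, k3⟩ <;> rcases hG.2.1 with ⟨g2, g3⟩ | ⟨g2, g3⟩
    · exact k3.symm.trans g3
    · exact absurd (g3.symm.trans k3) hvz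
    · exact absurd (g2.symm.trans k2) hvz
    · exact k2.symm.trans g2
  subst hzz'
  exact hnsh z ⟨g₀, hg₀, v₀, hg₀G⟩ ⟨h, hh, v, hG⟩

/-- **Outside-gated ⟹ no cross monomial** `(vᵢ, u)` with `vᵢ` a private of `cᵢ` and `u` a core variable of `cⱼ`. -/
theorem no_cross (hOᵢ : OutsideGated I J₀ 𝒢 cᵢ) (hcᵢ : cᵢ ∈ J₀) (hcⱼ : cⱼ ∈ J₀) {vᵢ u : Fin n} (hvᵢ : vᵢ = I.vars cᵢ 2 ∨ vᵢ = I.vars cᵢ 3)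
    (hu : u ∈ varSet I cⱼ) : ∀ h ∈ 𝒢, ¬ ((I.vars h 2 = vᵢ ∧ I.vars h 3 = u) ∨ (I.vars h 2 = u ∧ I.vars h 3 = vᵢ)) := by
  intro h hh H
  have hgv : I.vars h 2 = vᵢ ∨ I.vars h 3 = vᵢ := by
    rcases H with ⟨h2, -⟩ | ⟨-, h3⟩
    exacts [Or.inl h2, Or.inr h3]
  obtain ⟨z, hG⟩ := exists_gate_of_slot hOᵢ hcᵢ hh hvᵢ hgv
  have hvz : vᵢ ≠ z := hG.ne hcᵢ
  have huz : u = z := by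
    rcases H with ⟨k2, k3⟩ | ⟨k2, k3⟩ <;> rcases hG.2.1 with ⟨g2, g3⟩ | ⟨g2, g3⟩
    · exact k3.symm.trans g3
    · exact absurd (k2.symm.trans g2) hvz
    · exact absurd (k3.symm.trans g3) hvz
    · exact k2.symm.trans g2
  exact hG.2.2 cⱼ hcⱼ (huz ▸ hu)

/-- The `G`-partners (`G ⊆ 𝒢`) of a private of an outside-gated chord lie outside the core. -/
theorem partners_outside (hI : I.IsPure xorAndPred) (hO : OutsideGated I J₀ 𝒢 cᵢ) (hcᵢ : cᵢ ∈ J₀) {G : Finset (Fin m)} (hG : G ⊆ 𝒢)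
    {v : Fin n} (hv : v = I.vars cᵢ 2 ∨ v = I.vars cᵢ 3) : ∀ u ∈ partners I G v, ∀ j ∈ J₀, u ∉ varSet I j := by
  intro u hu
  obtain ⟨h, hh, H⟩ := (mem_partners_iff I hI).1 hu
  have hgv : I.vars h 2 = v ∨ I.vars h 3 = v := by
    rcases H with ⟨h2, -⟩ | ⟨-, h3⟩
    exacts [Or.inl h2, Or.inr h3]
  obtain ⟨z, hGz⟩ := exists_gate_of_slot hO hcᵢ (hG hh) hv hgv
  have hvz : v ≠ z := hGz.ne hcᵢ
  have huz : u = z := by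
    rcases H with ⟨k2, k3⟩ | ⟨k2, k3⟩ <;> rcases hGz.2.1 with ⟨g2, g3⟩ | ⟨g2, g3⟩
    · exact k3.symm.trans g3
    · exact absurd (k2.symm.trans g2) hvz
    · exact absurd (k3.symm.trans g3) hvz
    · exact k2.symm.trans g2
  rw [huz]; exact hGz.2.2

end Book

/-! ## The theorem -/
section Main

variable {I : LocalMap 4 n m} {r : ℕ} {y : Fin m → Bool} {J₀ : Finset (Fin m)} {w₁ w₂ : Finset (Fin n) × Finset (Fin m) × Bool}
  {cᵢ cⱼ : Fin m}

/-- **The type-`(1,0)` case of the two-chord theorem.** -/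
theorem false_of_two_gated_typeI (hI : I.IsPure xorAndPred) (hT : Typed I) (hS : SimpleOverlap I) (hB : BoundaryExpanding r I)
    (ht : Terminal I r y J₀ w₁ w₂) (hcᵢ : cᵢ ∈ J₀) (hcⱼ : cⱼ ∈ J₀) (hne : cᵢ ≠ cⱼ) (hchᵢ : IsChord I J₀ cᵢ) (hchⱼ : IsChord I J₀ cⱼ)
    (hOᵢ : OutsideGated I J₀ (w₁.2.1 ∪ w₂.2.1) cᵢ) (hOⱼ : OutsideGated I J₀ (w₁.2.1 ∪ w₂.2.1) cⱼ)
    (hnsh : ∀ z, Partner I J₀ (w₁.2.1 ∪ w₂.2.1) cᵢ z → Partner I J₀ (w₁.2.1 ∪ w₂.2.1) cⱼ z → False)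
    (hgenᵢ : SliceGeneric I y J₀ cᵢ (w₁.2.1 ∪ w₂.2.1)) (hgenⱼ : SliceGeneric I y J₀ cⱼ (w₁.2.1 ∪ w₂.2.1))
    {gᵢ : Fin m} {vᵢ zᵢ : Fin n} (hgᵢ : gᵢ ∈ w₁.2.1 ∪ w₂.2.1) (hGᵢ : IsGate I J₀ cᵢ gᵢ vᵢ zᵢ) (hgᵢ₁ : gᵢ ∈ w₁.2.1) (hgᵢ₂ : gᵢ ∉ w₂.2.1)
    (hexⱼ : ∃ g ∈ w₁.2.1 ∪ w₂.2.1, Touches I cⱼ g) : False := by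
  classical
  have hv := exists_xor_not_mem_of_simpleOverlap hI hS hne
  have hnsh' : ∀ z, Partner I J₀ (w₁.2.1 ∪ w₂.2.1) cⱼ z → Partner I J₀ (w₁.2.1 ∪ w₂.2.1) cᵢ z → False :=
    fun z h h' => hnsh z h' h
  -- the gate on `cⱼ`, co-privates, partners
  obtain ⟨gⱼ, hgⱼ, htⱼ⟩ := hexⱼ
  obtain ⟨vⱼ, zⱼ, hGⱼ⟩ := hOⱼ gⱼ hgⱼ htⱼ
  obtain ⟨vᵢ', hvᵢ⟩ := exists_copriv hGᵢ.1
  obtain ⟨vⱼ', hvⱼ⟩ := exists_copriv hGⱼ.1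
  have hPᵢ : Partner I J₀ (w₁.2.1 ∪ w₂.2.1) cᵢ zᵢ := ⟨gᵢ, hgᵢ, vᵢ, hGᵢ⟩
  have hPⱼ : Partner I J₀ (w₁.2.1 ∪ w₂.2.1) cⱼ zⱼ := ⟨gⱼ, hgⱼ, vⱼ, hGⱼ⟩
  have memᵢ : vᵢ ∈ varSet I cᵢ := by rcases hGᵢ.1 with e | e <;> rw [e] <;> exact vars_mem_varSet I cᵢ _
  have memⱼ : vⱼ ∈ varSet I cⱼ := by rcases hGⱼ.1 with e | e <;> rw [e] <;> exact vars_mem_varSet I cⱼ _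
  -- one solution with all four privates `0`
  obtain ⟨x, hx, hx2ᵢ, hx3ᵢ, hx2ⱼ, hx3ⱼ⟩ := exists_two_slices hI hcᵢ hcⱼ hne hchᵢ hchⱼ hv hgenᵢ false false false false
  -- any outside gate on `cᵢ` and any outside gate on `cⱼ` have the same type
  have TYPES : ∀ {g g' : Fin m} {v z v' z' : Fin n}, g ∈ w₁.2.1 ∪ w₂.2.1 → IsGate I J₀ cᵢ g v z → g' ∈ w₁.2.1 ∪ w₂.2.1 →
      IsGate I J₀ cⱼ g' v' z' → decide (g ∈ w₁.2.1) = decide (g' ∈ w₁.2.1) ∧ decide (g ∈ w₂.2.1) = decide (g' ∈ w₂.2.1) := by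
    intro g g' v z v' z' hg hG hg' hG'
    obtain ⟨u, hu⟩ := exists_copriv hG.1
    obtain ⟨u', hu'⟩ := exists_copriv hG'.1
    have mem' : v' ∈ varSet I cⱼ := by rcases hG'.1 with e | e <;> rw [e] <;> exact vars_mem_varSet I cⱼ _
    exact type_eq' hI hS ht hcᵢ hcⱼ hne hchᵢ hchⱼ hu hu' hg hG.2.1 hG.2.2 hg' hG'.2.1 hG'.2.2 (no_cross hOᵢ hcᵢ hcⱼ hG.1 mem')
      (no_pair_priv' hnsh' hOᵢ hcᵢ ⟨g', hg', v', hG'⟩ hG.1) hx (copriv_false hu hx2ᵢ hx3ᵢ) (copriv_false hu' hx2ⱼ hx3ⱼ)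
  -- so `gⱼ` has type `(1,0)` …
  obtain ⟨e₁, e₂⟩ := TYPES hgᵢ hGᵢ hgⱼ hGⱼ
  rw [decide_eq_true hgᵢ₁] at e₁
  rw [decide_eq_false hgᵢ₂] at e₂
  have hgⱼ₁ : gⱼ ∈ w₁.2.1 := of_decide_eq_true e₁.symm
  have hgⱼ₂ : gⱼ ∉ w₂.2.1 := of_decide_eq_false e₂.symm
  -- … and no monomial of `G₂` touches either AND pair
  have hmonoᵢ : ∀ h ∈ w₂.2.1,
      (I.vars h 2 ≠ I.vars cᵢ 2 ∧ I.vars h 3 ≠ I.vars cᵢ 2) ∧ (I.vars h 2 ≠ I.vars cᵢ 3 ∧ I.vars h 3 ≠ I.vars cᵢ 3) := by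
    intro h hh
    by_contra H
    obtain ⟨v, z, hG⟩ := hOᵢ h (mem_union_right _ hh) H
    obtain ⟨-, e⟩ := TYPES (mem_union_right _ hh) hG hgⱼ hGⱼ
    rw [decide_eq_true hh, decide_eq_false hgⱼ₂] at e
    exact absurd e (by decide)
  have hmonoⱼ : ∀ h ∈ w₂.2.1,
      (I.vars h 2 ≠ I.vars cⱼ 2 ∧ I.vars h 3 ≠ I.vars cⱼ 2) ∧ (I.vars h 2 ≠ I.vars cⱼ 3 ∧ I.vars h 3 ≠ I.vars cⱼ 3) := by
    intro h hh
    by_contra H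
    obtain ⟨v, z, hG⟩ := hOⱼ h (mem_union_right _ hh) H
    obtain ⟨-, e⟩ := TYPES hgᵢ hGᵢ (mem_union_right _ hh) hG
    rw [decide_eq_true hh, decide_eq_false hgᵢ₂] at e
    exact absurd e (by decide)
  have hvGᵢ : ∀ g ∈ w₂.2.1, I.vars g 2 ≠ vᵢ ∧ I.vars g 3 ≠ vᵢ := by
    intro g hg; rcases hGᵢ.1 with e | e <;> rw [e]
    exacts [(hmonoᵢ g hg).1, (hmonoᵢ g hg).2]
  have hvGⱼ : ∀ g ∈ w₂.2.1, I.vars g 2 ≠ vⱼ ∧ I.vars g 3 ≠ vⱼ := by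
    intro g hg; rcases hGⱼ.1 with e | e <;> rw [e]
    exacts [(hmonoⱼ g hg).1, (hmonoⱼ g hg).2]
  -- pair facts for the designated gates
  have hcrossᵢ := no_cross hOᵢ hcᵢ hcⱼ hGᵢ.1 memⱼ   -- no `(vᵢ, vⱼ)`
  have hcrossⱼ := no_cross hOⱼ hcⱼ hcᵢ hGⱼ.1 memᵢ   -- no `(vⱼ, vᵢ)`
  have hnoⱼ := no_pair_priv' hnsh' hOᵢ hcᵢ hPⱼ hGᵢ.1  -- no `(vᵢ, zⱼ)`
  have hnoᵢ := no_pair_priv' hnsh hOⱼ hcⱼ hPᵢ hGⱼ.1   -- no `(vⱼ, zᵢ)`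
  have h0ᵢ := copriv_false hvᵢ hx2ᵢ hx3ᵢ
  have h0ⱼ := copriv_false hvⱼ hx2ⱼ hx3ⱼ
  -- the gated privates are not read by `Γ₂`
  have hvᵢC : vᵢ ∉ w₂.1 :=
    not_mem_lin₂' hI hS ht hcᵢ hcⱼ hne hchᵢ hchⱼ hvᵢ hvⱼ hgⱼ₁ hgⱼ₂ hGⱼ.2.1 hGⱼ.2.2 hcrossᵢ hnoⱼ hvGᵢ hx h0ᵢ h0ⱼ
  have hvⱼC : vⱼ ∉ w₂.1 :=
    not_mem_lin₂' hI hS ht hcⱼ hcᵢ hne.symm hchⱼ hchᵢ hvⱼ hvᵢ hgᵢ₁ hgᵢ₂ hGᵢ.2.1 hGᵢ.2.2 hcrossⱼ hnoᵢ hvGⱼ hx h0ⱼ h0ᵢ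
  -- the INVISIBLE / FULL dichotomy for the designated switches
  have Mᵢ : ∀ P : Fin n → Bool, (∀ j ∈ J₀, I.eval P j = y j) → P vⱼ' = false →
      mv I w₂.1 w₂.2.1 zᵢ P = (decide (zⱼ ∈ partners I w₂.2.1 zᵢ) && !mv I w₁.1 w₁.2.1 vⱼ P) :=
    fun P hP hP0 => mv₂_eq_of_typeI hI hS ht hcⱼ hchⱼ hvⱼ hgⱼ₁ hGⱼ.2.1 hGⱼ.2.2 hvⱼC hvGⱼ hGᵢ.2.2 hnoᵢ hP hP0
  have Mⱼ : ∀ P : Fin n → Bool, (∀ j ∈ J₀, I.eval P j = y j) → P vᵢ' = false →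
      mv I w₂.1 w₂.2.1 zⱼ P = (decide (zᵢ ∈ partners I w₂.2.1 zⱼ) && !mv I w₁.1 w₁.2.1 vᵢ P) :=
    fun P hP hP0 => mv₂_eq_of_typeI hI hS ht hcᵢ hchᵢ hvᵢ hgᵢ₁ hGᵢ.2.1 hGᵢ.2.2 hvᵢC hvGᵢ hGⱼ.2.2 hnoⱼ hP hP0
  have hκ : (zⱼ ∈ partners I w₂.2.1 zᵢ) ↔ (zᵢ ∈ partners I w₂.2.1 zⱼ) := by
    rw [mem_partners_iff I hI, mem_partners_iff I hI]
    exact ⟨fun ⟨h, hh, H⟩ => ⟨h, hh, H.symm⟩, fun ⟨h, hh, H⟩ => ⟨h, hh, H.symm⟩⟩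
  -- no-pair facts for the partners against the other chord's two private slots
  have hnoᵢ₂ := no_pair_priv' hnsh hOⱼ hcⱼ hPᵢ (Or.inl rfl : I.vars cⱼ 2 = I.vars cⱼ 2 ∨ _)
  have hnoᵢ₃ := no_pair_priv' hnsh hOⱼ hcⱼ hPᵢ (Or.inr rfl : _ ∨ I.vars cⱼ 3 = I.vars cⱼ 3)
  have hnoⱼ₂ := no_pair_priv' hnsh' hOᵢ hcᵢ hPⱼ (Or.inl rfl : I.vars cᵢ 2 = I.vars cᵢ 2 ∨ _)
  have hnoⱼ₃ := no_pair_priv' hnsh' hOᵢ hcᵢ hPⱼ (Or.inr rfl : _ ∨ I.vars cᵢ 3 = I.vars cᵢ 3)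
  by_cases hκᵢ : zⱼ ∈ partners I w₂.2.1 zᵢ
  · -- FULL – FULL
    have hκⱼ : zᵢ ∈ partners I w₂.2.1 zⱼ := hκ.1 hκᵢ
    have Fᵢ := full_of_mv₂_eq (w₁ := w₁) (z := zᵢ) (vⱼ := vⱼ) hI hT hS hcⱼ hchⱼ hgenⱼ
      (partners_outside hI hOⱼ hcⱼ subset_union_left hGⱼ.1)
      (fun h hh H => hnoᵢ₂ h (mem_union_right _ hh) H.symm) (fun h hh H => hnoᵢ₃ h (mem_union_right _ hh) H.symm)
      (fun P hP hP2 hP3 => by rw [Mᵢ P hP (copriv_false hvⱼ hP2 hP3), decide_eq_true hκᵢ, Bool.true_and])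
      ⟨x, hx, hx2ⱼ, hx3ⱼ⟩
    have Fⱼ := full_of_mv₂_eq (w₁ := w₁) (z := zⱼ) (vⱼ := vᵢ) hI hT hS hcᵢ hchᵢ hgenᵢ
      (partners_outside hI hOᵢ hcᵢ subset_union_left hGᵢ.1)
      (fun h hh H => hnoⱼ₂ h (mem_union_right _ hh) H.symm) (fun h hh H => hnoⱼ₃ h (mem_union_right _ hh) H.symm)
      (fun P hP hP2 hP3 => by rw [Mⱼ P hP (copriv_false hvᵢ hP2 hP3), decide_eq_true hκⱼ, Bool.true_and])
      ⟨x, hx, hx2ᵢ, hx3ᵢ⟩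
    have hFᵢ : ∀ x : Fin n → Bool, mv I w₂.1 w₂.2.1 zᵢ x = !mv I w₁.1 w₁.2.1 vⱼ x := by
      intro x
      rw [mv_eq_partners I hI hS, mv_eq_partners I hI hS, Fᵢ.1]
      by_cases h : vⱼ ∈ w₁.1
      · rw [decide_eq_true h, decide_eq_false (fun h' => Fᵢ.2.1 h' h)]; cases gval I (partners I w₁.2.1 vⱼ) ∅ x <;> rfl
      · rw [decide_eq_false h, decide_eq_true (Fᵢ.2.2 h)]; cases gval I (partners I w₁.2.1 vⱼ) ∅ x <;> rfl
    have hFⱼ : ∀ x : Fin n → Bool, mv I w₂.1 w₂.2.1 zⱼ x = !mv I w₁.1 w₁.2.1 vᵢ x := by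
      intro x
      rw [mv_eq_partners I hI hS, mv_eq_partners I hI hS, Fⱼ.1]
      by_cases h : vᵢ ∈ w₁.1
      · rw [decide_eq_true h, decide_eq_false (fun h' => Fⱼ.2.1 h' h)]; cases gval I (partners I w₁.2.1 vᵢ) ∅ x <;> rfl
      · rw [decide_eq_false h, decide_eq_true (Fⱼ.2.2 h)]; cases gval I (partners I w₁.2.1 vᵢ) ∅ x <;> rfl
    exact false_of_full hI hT hS hB ht hcᵢ hcⱼ hne hchᵢ hchⱼ hv hvᵢ hvⱼ hgᵢ₁ hGᵢ.2.1 hGᵢ.2.2 hgⱼ₁ hGⱼ.2.1 hGⱼ.2.2 hvᵢC hvⱼC hmonoᵢ hmonoⱼ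
      (fun h hh H => hcrossᵢ h hh H.symm) hFᵢ hFⱼ (partners_outside hI hOᵢ hcᵢ subset_union_left hGᵢ.1)
      (partners_outside hI hOⱼ hcⱼ subset_union_left hGⱼ.1) hgenᵢ hgenⱼ
  · -- INVISIBLE – INVISIBLE
    have hκⱼ : zᵢ ∉ partners I w₂.2.1 zⱼ := fun h => hκᵢ (hκ.2 h)
    have hinvᵢ := invisible_of_mv₂_zero (z := zᵢ) hI hT hS hcⱼ hchⱼ hgenⱼ
      (fun h hh H => hnoᵢ₂ h (mem_union_right _ hh) H.symm) (fun h hh H => hnoᵢ₃ h (mem_union_right _ hh) H.symm)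
      (fun P hP hP2 hP3 => by rw [Mᵢ P hP (copriv_false hvⱼ hP2 hP3), decide_eq_false hκᵢ, Bool.false_and])
      ⟨x, hx, hx2ⱼ, hx3ⱼ⟩
    have hinvⱼ := invisible_of_mv₂_zero (z := zⱼ) hI hT hS hcᵢ hchᵢ hgenᵢ
      (fun h hh H => hnoⱼ₂ h (mem_union_right _ hh) H.symm) (fun h hh H => hnoⱼ₃ h (mem_union_right _ hh) H.symm)
      (fun P hP hP2 hP3 => by rw [Mⱼ P hP (copriv_false hvᵢ hP2 hP3), decide_eq_false hκⱼ, Bool.false_and])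
      ⟨x, hx, hx2ᵢ, hx3ᵢ⟩
    have hlocᵢ : ChordLocal I cᵢ w₂.1 w₂.2.1 :=
      chordLocal₂_of_clean hI hS ht hcᵢ hchᵢ hvᵢ hgᵢ₁ hGᵢ.2.1 hGᵢ.2.2 hinvᵢ.1 hinvᵢ.2 hvᵢC hmonoᵢ subset_union_right hgenᵢ
    have hlocⱼ : ChordLocal I cⱼ w₂.1 w₂.2.1 :=
      chordLocal₂_of_clean hI hS ht hcⱼ hchⱼ hvⱼ hgⱼ₁ hGⱼ.2.1 hGⱼ.2.2 hinvⱼ.1 hinvⱼ.2 hvⱼC hmonoⱼ subset_union_right hgenⱼ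
    refine false_of_gval₂_const hI hT hS hB ht fun x x' => ?_
    rw [gval_eq_false_of_two_chordLocal hI hcᵢ hcⱼ hne hchᵢ hv hlocᵢ hlocⱼ x,
      gval_eq_false_of_two_chordLocal hI hcᵢ hcⱼ hne hchᵢ hv hlocᵢ hlocⱼ x']

/-- **THE TWO-CHORD THEOREM.**  On a pure typed `(r,3/2)`-expanding instance with simple overlaps, a terminal core has no two distinct
OUTSIDE-GATED SLICE-GENERIC chords without a common partner. -/
theorem false_of_two_gated (hI : I.IsPure xorAndPred) (hT : Typed I) (hS : SimpleOverlap I) (hB : BoundaryExpanding r I)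
    (ht : Terminal I r y J₀ w₁ w₂) (hcᵢ : cᵢ ∈ J₀) (hcⱼ : cⱼ ∈ J₀) (hne : cᵢ ≠ cⱼ) (hchᵢ : IsChord I J₀ cᵢ) (hchⱼ : IsChord I J₀ cⱼ)
    (hOᵢ : OutsideGated I J₀ (w₁.2.1 ∪ w₂.2.1) cᵢ) (hOⱼ : OutsideGated I J₀ (w₁.2.1 ∪ w₂.2.1) cⱼ)
    (hnsh : ∀ z, Partner I J₀ (w₁.2.1 ∪ w₂.2.1) cᵢ z → Partner I J₀ (w₁.2.1 ∪ w₂.2.1) cⱼ z → False)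
    (hgenᵢ : SliceGeneric I y J₀ cᵢ (w₁.2.1 ∪ w₂.2.1)) (hgenⱼ : SliceGeneric I y J₀ cⱼ (w₁.2.1 ∪ w₂.2.1)) : False := by
  classical
  by_cases hexᵢ : ∃ g ∈ w₁.2.1 ∪ w₂.2.1, Touches I cᵢ g
  swap
  · push Not at hexᵢ
    exact false_of_monomial_free_chord I hI hT hS hB ht hcᵢ hchᵢ (fun g hg => avoids_of_not_touches (hexᵢ g hg)) hgenᵢ
  by_cases hexⱼ : ∃ g ∈ w₁.2.1 ∪ w₂.2.1, Touches I cⱼ g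
  swap
  · push Not at hexⱼ
    exact false_of_monomial_free_chord I hI hT hS hB ht hcⱼ hchⱼ (fun g hg => avoids_of_not_touches (hexⱼ g hg)) hgenⱼ
  obtain ⟨gᵢ, hgᵢ, htᵢ⟩ := hexᵢ
  obtain ⟨vᵢ, zᵢ, hGᵢ⟩ := hOᵢ gᵢ hgᵢ htᵢ
  by_cases h₁ : gᵢ ∈ w₁.2.1 <;> by_cases h₂ : gᵢ ∈ w₂.2.1
  · -- type `(1,1)`: pass to the sum reader
    have hGG := union_symmDiff_eq w₁.2.1 w₂.2.1
    obtain ⟨gⱼ, hgⱼ, htⱼ⟩ := hexⱼ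
    refine false_of_two_gated_typeI (w₂ := (w₁.1 ∆ w₂.1, w₁.2.1 ∆ w₂.2.1, xor w₁.2.2 w₂.2.2)) hI hT hS hB (terminal_sum ht)
      hcᵢ hcⱼ hne hchᵢ hchⱼ ?_ ?_ ?_ ?_ ?_ (gᵢ := gᵢ) ?_ hGᵢ h₁ ?_ ?_
    · show OutsideGated I J₀ (w₁.2.1 ∪ w₁.2.1 ∆ w₂.2.1) cᵢ; rw [hGG]; exact hOᵢ
    · show OutsideGated I J₀ (w₁.2.1 ∪ w₁.2.1 ∆ w₂.2.1) cⱼ; rw [hGG]; exact hOⱼ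
    · show ∀ z, Partner I J₀ (w₁.2.1 ∪ w₁.2.1 ∆ w₂.2.1) cᵢ z → Partner I J₀ (w₁.2.1 ∪ w₁.2.1 ∆ w₂.2.1) cⱼ z → False
      rw [hGG]; exact hnsh
    · show SliceGeneric I y J₀ cᵢ (w₁.2.1 ∪ w₁.2.1 ∆ w₂.2.1); rw [hGG]; exact hgenᵢ
    · show SliceGeneric I y J₀ cⱼ (w₁.2.1 ∪ w₁.2.1 ∆ w₂.2.1); rw [hGG]; exact hgenⱼ
    · show gᵢ ∈ w₁.2.1 ∪ w₁.2.1 ∆ w₂.2.1; rw [hGG]; exact hgᵢ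
    · show gᵢ ∉ w₁.2.1 ∆ w₂.2.1
      rw [Finset.mem_symmDiff]; push Not; exact ⟨fun _ => h₂, fun _ => h₁⟩
    · exact ⟨gⱼ, by show gⱼ ∈ w₁.2.1 ∪ w₁.2.1 ∆ w₂.2.1; rw [hGG]; exact hgⱼ, htⱼ⟩
  · -- type `(1,0)`
    exact false_of_two_gated_typeI hI hT hS hB ht hcᵢ hcⱼ hne hchᵢ hchⱼ hOᵢ hOⱼ hnsh hgenᵢ hgenⱼ hgᵢ hGᵢ h₁ h₂ hexⱼ
  · -- type `(0,1)`: exchange the readers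
    rw [union_comm] at hOᵢ hOⱼ hnsh hgenᵢ hgenⱼ hgᵢ hexⱼ
    exact false_of_two_gated_typeI hI hT hS hB (terminal_symm ht) hcᵢ hcⱼ hne hchᵢ hchⱼ hOᵢ hOⱼ hnsh hgenᵢ hgenⱼ hgᵢ hGᵢ h₂ h₁ hexⱼ
  · exact absurd hgᵢ (by rw [mem_union, not_or]; exact ⟨h₁, h₂⟩)

end Main

end Summit.PneNP.PneNP.Theorems.PstarChordReadTwoChords
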